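/-
Copyright: the b2b-balaban T⁴-continuum CRUX team, row NE7b OWNER lineage `t4-ne7b-p1` (gen 129). Project licence.
-/
import Summits.QuantumFields.BalabanUV.T4Continuum.Spine.NE7b.SupEffectiveActionDerivative
import Summits.QuantumFields.BalabanUV.T4Continuum.Spine.NE7b.SupJointConvexity
import Summits.QuantumFields.BalabanUV.T4Continuum.Spine.NE7b.SupConvexStepIntegrated
import Literature.MathematicalPhysics.QuantumFieldTheory.Balaban1983to89.B2Eq228Conditioning

/-!
# THE LOWER SECOND-ORDER LETTER OF THE NEXT POTENTIAL BY PRÉKOPA–LEINDLER: for a positive-definite precision `M` with floor `m`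
# (`m·Σz² ≤ ⟨z,Mz⟩`), remainders `w_x ∈ C¹` with the LOWER first-order letter of constant `λ_w` and `2λ_w ≤ m`,
#   `−log Z(ψ') ≥ −log Z(ψ) + D(−log Z)(ψ)(ψ'−ψ) − λ_w·Σ_{p∈C}Σ_{x∈cell p}(ψ'_x−ψ_x)²`,  `Z(ψ) = ∫e^{−Σ_{p∈C}Σ_{x∈cell p}w_x(ω_x+ψ_x)}dN(0,M⁻¹)`,
# at EVERY `ψ, ψ'`: `ψ ↦ −log Z(ψ) + λ_wΣψ²` is CONVEX (Prékopa–Leindler on `ι → ℝ` with the jointly convex action of (317), read through the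
# Gaussian dictionary `gaussProb M = N(0,M⁻¹)∘ofLp`), and (313)'s differentiability turns the secant letter into the first-order one.  With
# (316) the next potential is in the two-sided second-order class `(−2λ_w, Λ_w)` — the re-entry at second order, NO smallness used (row NE7b,
# node U5c; (317) + the convex column's `prekopaLeindler_fintype` + the tree's `B2Eq228Conditioning` dictionary + (313) BY NAME; [folklore];
# [cite: BrascampLieb1976, Thm 4.3] for the marginal inequality)

Cell `pub-balaban`, sub-cell `t4`, spine estimate NE7b (`T4WeightBudget.RelWeightBound`; the cell's OWN estimate — NOT PRINTED in
[Bałaban 1983–89], NOT PROVED).  Crux-route work under `Spine/NE7b/` by the row OWNER (`t4-ne7b-p1` gen 129, file (318)) under FREEZE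
(0)'s crux-prover clause, on § [NE7bP1-G129-HANDOFF] NEXT (3)(a); NOTHING of Bałaban's is named as a Lean object, valued or asserted; no
`T4Continuum/Support` leaf typed; no `def`, no notation; zero `sorry`.  Imports (BY NAME): the OWNER's (317) `…SupJointConvexity`
(`jointAction_secant`, `firstOrder_of_secant_hasFDerivAt'`), (313) `…SupEffectiveActionDerivative` (`hasFDerivAt_neg_log_step`,
`fderiv_neg_log_step_apply`), (306) (`measurable_cellSum`, `cellSum_eq_sum_biUnion`), (297) (`integrable_exp_neg`), (288)
(`transpose_eq_of_posSemidef`), the convex column's (116) `…SupConvexStepIntegrated` (`prekopaLeindler_fintype`); the tree's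
`B2Eq228Conditioning` (`gaussProb`, `gaussProb_eq_map_multivariateGaussian`, `gaussNorm_pos`, `gaussWeight_pos`, `measurable_gaussWeight_real`),
`B13GaugeDevices` (`gaussWeight`, `gaussNorm`); Mathlib's `lintegral_withDensity_eq_lintegral_mul`, `lintegral_smul_measure`, `lintegral_map_equiv`,
`ofReal_integral_eq_lintegral_ofReal`.

WHY (located).  (316) gave the upper curvature by Jensen; the lower curvature is the marginal log-concavity of Brascamp–Lieb∕Prékopa: if the
JOINT action in (fluctuation, external field) is convex after adding `λ_w|ψ|²`, so is its `−log`-marginal.  (317) proved the joint secant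
letter under `2λ_w ≤ m`; here the fluctuation integral against `N(0,M⁻¹)` is written as a Lebesgue integral with the density
`e^{−½⟨z,Mz⟩}∕gaussNorm` (the tree's dictionary), Prékopa–Leindler is applied on the finite carrier `ι → ℝ`, the normalisation cancels in
the secant letter, and (313) converts secant to first order.

WHAT IS PROVED ([folklore]; `M ≻ 0` with floor `m`, `Z(ψ)` as above, `V(ψ,z) = Σ_{p∈C}Σ_{u∈cell p}w_u(z_u+ψ_u)`):
* §1 `measurable_jointAction_exp`, **`lintegral_jointAction_eq`** (`∫⁻ ofReal(e^{−½⟨z,Mz⟩−V(ψ,z)−λ_wΣψ²})dz = ofReal(e^{−λ_wΣψ²}·gaussNorm M·Z(ψ))`);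
* §2 **`neg_log_step_secant`** (the secant letter: `W̃((1−s)ψ₀+sψ₁) ≤ (1−s)W̃(ψ₀) + sW̃(ψ₁)`, `W̃ = −log Z + λ_wΣψ²`, `0 ≤ s ≤ 1`);
* §3 `hasFDerivAt_shift` (the derivative of `λ_wΣψ²`), THE END **`neg_log_step_lower_letter`**:
  `−log Z(ψ) + (fderiv ℝ (−log Z) ψ)(ψ'−ψ) − λ_wΣ_{p∈C}Σ_{u∈cell p}(ψ'_u−ψ_u)² ≤ −log Z(ψ')`; §4 toy.

HONEST (what this is NOT).  Positive-DEFINITE covariance only (the dictionary needs a density; singular scale covariances are not covered);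
constant `2λ_w` (twice the remainders' lower constant), the price of joint convexity; no third-order control; scalar skeleton ((A3), NC-NE7b-α
UNRULED); nothing of Bałaban's asserted.  BY-NAME EFFECT ON THE WALL: NONE.  NE7b NOT PRINTED ∕ NOT PROVED; spine PROVED 0∕9; rung (B)+1 — the
programme's measures remain FINITE-torus statements; NOT the mass gap, NOT Clay.  HONEST DEPENDENCY: continuum YM on T⁴ ⇐ BetaPertH ∧ nine
spine estimates (0∕9 proved); BetaPertH ⇐ (D1) ∧ (D4) ∧ CAP+tail; G-an2-4 gates asym, D1 and NE2∕3∕4.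
-/

set_option autoImplicit false

noncomputable section

namespace Summit.QuantumFields.BalabanUV.T4Continuum.NE7b.SupEffectiveActionLowerLetter

open MeasureTheory ProbabilityTheory Finset Real
open scoped BigOperators ENNReal Matrix
open Literature.MathematicalPhysics.QuantumFieldTheory.Balaban1983to89
open B13GaugeDevices (gaussWeight gaussNorm)
open B2Eq228Conditioning (gaussProb gaussProb_eq_map_multivariateGaussian gaussNorm_pos gaussWeight_pos measurable_gaussWeight_real)
open SupJointConvexity (jointAction_secant firstOrder_of_secant_hasFDerivAt')
open SupEffectiveActionDerivative (hasFDerivAt_neg_log_step fderiv_neg_log_step_apply)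
open SupSmallFieldGasReal (measurable_cellSum cellSum_eq_sum_biUnion)
open SupFluctuationAPriori (integrable_exp_neg)
open SupGaussianRegulator (transpose_eq_of_posSemidef)
open SupConvexStepIntegrated (prekopaLeindler_fintype)

variable {ι : Type} [Fintype ι] [DecidableEq ι] {V : Type*}

section Main

variable {M : Matrix ι ι ℝ} {γop m : ℝ} {cell : V → Finset ι} {w w' : ι → ℝ → ℝ} {κ₀ κ₁ lamw τ δ θ : ℝ}

/-! ## §1. The joint action as a Lebesgue integral: the Gaussian dictionary -/

omit [DecidableEq ι] in
/-- The Lebesgue integrand `z ↦ ofReal(e^{−S_ψ(z)})` is measurable (measurable remainders). [folklore] -/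
theorem measurable_jointAction_exp (M : Matrix ι ι ℝ) (cell : V → Finset ι) {w : ι → ℝ → ℝ} (hw : ∀ x, Measurable (w x))
    (lamw : ℝ) (C : Finset V) (ψ : ι → ℝ) :
    Measurable fun z : ι → ℝ => ENNReal.ofReal (exp (-(1 / 2 * (z ⬝ᵥ (M *ᵥ z)) + ∑ p ∈ C, ∑ u ∈ cell p, w u (z u + ψ u) +
      lamw * ∑ p ∈ C, ∑ u ∈ cell p, ψ u ^ 2))) := by
  have hq : Measurable fun z : ι → ℝ => 1 / 2 * (z ⬝ᵥ (M *ᵥ z)) := by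
    have h := measurable_gaussWeight_real M
    -- `gaussWeight M z = exp(−½⟨z,Mz⟩)`, so `½⟨z,Mz⟩ = −log(gaussWeight M z)`
    have he : (fun z : ι → ℝ => 1 / 2 * (z ⬝ᵥ (M *ᵥ z))) = fun z => -Real.log (gaussWeight M z) := by
      funext z
      rw [gaussWeight, Real.log_exp]
      ring
    rw [he]
    exact (measurable_log.comp h).neg
  have hV : Measurable fun z : ι → ℝ => ∑ p ∈ C, ∑ u ∈ cell p, w u (z u + ψ u) :=
    Finset.measurable_sum C fun p _ => Finset.measurable_sum (cell p) fun u _ =>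
      (hw u).comp ((measurable_pi_apply u : Measurable fun z : ι → ℝ => z u).add_const (ψ u))
  exact (measurable_exp.comp ((hq.add hV).add measurable_const).neg).ennreal_ofReal

/-- **THE DICTIONARY**: `M ≻ 0`, `e^{−V(ψ,·)}` integrable for `N(0,M⁻¹)` ⟹
`∫⁻ ofReal(e^{−½⟨z,Mz⟩ − V(ψ,z) − λ_wΣψ²}) dz = ofReal(e^{−λ_wΣψ²}·gaussNorm M·∫e^{−V(ψ,ω)}dN(0,M⁻¹)(ω))`. [folklore] -/
theorem lintegral_jointAction_eq (hM : M.PosDef) (cell : V → Finset ι) {w : ι → ℝ → ℝ} (hw : ∀ x, Measurable (w x)) (lamw : ℝ)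
    (C : Finset V) (ψ : ι → ℝ)
    (hI : Integrable (fun ω : EuclideanSpace ℝ ι => exp (-(∑ p ∈ C, ∑ u ∈ cell p, w u (ω u + ψ u)))) (multivariateGaussian 0 M⁻¹)) :
    ∫⁻ z : ι → ℝ, ENNReal.ofReal (exp (-(1 / 2 * (z ⬝ᵥ (M *ᵥ z)) + ∑ p ∈ C, ∑ u ∈ cell p, w u (z u + ψ u) +
        lamw * ∑ p ∈ C, ∑ u ∈ cell p, ψ u ^ 2))) =
      ENNReal.ofReal (exp (-(lamw * ∑ p ∈ C, ∑ u ∈ cell p, ψ u ^ 2)) * gaussNorm M *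
        ∫ ω : EuclideanSpace ℝ ι, exp (-(∑ p ∈ C, ∑ u ∈ cell p, w u (ω u + ψ u))) ∂(multivariateGaussian 0 M⁻¹)) := by
  set F : (ι → ℝ) → ℝ := fun z => exp (-(∑ p ∈ C, ∑ u ∈ cell p, w u (z u + ψ u))) with hF
  have hFm : Measurable F := measurable_exp.comp (Finset.measurable_sum C fun p _ =>
    Finset.measurable_sum (cell p) fun u _ =>
      (hw u).comp ((measurable_pi_apply u : Measurable fun z : ι → ℝ => z u).add_const (ψ u))).neg
  have hρm : Measurable fun z : ι → ℝ => ENNReal.ofReal (gaussWeight M z) := (measurable_gaussWeight_real M).ennreal_ofReal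
  have hgN := gaussNorm_pos hM
  -- split the integrand
  have hsplit : ∀ z : ι → ℝ, ENNReal.ofReal (exp (-(1 / 2 * (z ⬝ᵥ (M *ᵥ z)) + ∑ p ∈ C, ∑ u ∈ cell p, w u (z u + ψ u) +
      lamw * ∑ p ∈ C, ∑ u ∈ cell p, ψ u ^ 2))) =
      ENNReal.ofReal (exp (-(lamw * ∑ p ∈ C, ∑ u ∈ cell p, ψ u ^ 2))) * (ENNReal.ofReal (gaussWeight M z) * ENNReal.ofReal (F z)) := by
    intro z
    rw [← ENNReal.ofReal_mul (gaussWeight_pos M z).le, ← ENNReal.ofReal_mul (exp_pos _).le, gaussWeight, hF, ← exp_add, ← exp_add]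
    congr 1
    ring
  simp_rw [hsplit]
  have hm2 : Measurable fun z : ι → ℝ => ENNReal.ofReal (gaussWeight M z) * ENNReal.ofReal (F z) := hρm.mul hFm.ennreal_ofReal
  rw [lintegral_const_mul _ hm2]
  -- the weighted Lebesgue integral is `gaussNorm · ∫⁻ dμ_{M⁻¹}`
  have hwd : ∫⁻ z : ι → ℝ, ENNReal.ofReal (gaussWeight M z) * ENNReal.ofReal (F z) =
      ∫⁻ z : ι → ℝ, ENNReal.ofReal (F z) ∂(volume.withDensity fun z => ENNReal.ofReal (gaussWeight M z)) := by
    rw [lintegral_withDensity_eq_lintegral_mul _ hρm hFm.ennreal_ofReal]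
    rfl
  have hgp : ∫⁻ z : ι → ℝ, ENNReal.ofReal (F z) ∂(gaussProb M) =
      ENNReal.ofReal (gaussNorm M)⁻¹ * ∫⁻ z : ι → ℝ, ENNReal.ofReal (F z) ∂(volume.withDensity fun z => ENNReal.ofReal (gaussWeight M z)) := by
    rw [gaussProb, lintegral_smul_measure, smul_eq_mul]
  have hwd' : ∫⁻ z : ι → ℝ, ENNReal.ofReal (gaussWeight M z) * ENNReal.ofReal (F z) =
      ENNReal.ofReal (gaussNorm M) * ∫⁻ z : ι → ℝ, ENNReal.ofReal (F z) ∂(gaussProb M) := by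
    rw [hwd, hgp, ← mul_assoc, ← ENNReal.ofReal_mul hgN.le, mul_inv_cancel₀ hgN.ne', ENNReal.ofReal_one, one_mul]
  -- `dμ_{M⁻¹}` is `N(0,M⁻¹)` read on `ι → ℝ`
  have hmap : ∫⁻ z : ι → ℝ, ENNReal.ofReal (F z) ∂(gaussProb M) =
      ∫⁻ ω : EuclideanSpace ℝ ι, ENNReal.ofReal (exp (-(∑ p ∈ C, ∑ u ∈ cell p, w u (ω u + ψ u)))) ∂(multivariateGaussian 0 M⁻¹) := by
    rw [gaussProb_eq_map_multivariateGaussian hM, lintegral_map_equiv]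
    rfl
  rw [hwd', hmap, ← ofReal_integral_eq_lintegral_ofReal hI (ae_of_all _ fun ω => (exp_pos _).le), ← ENNReal.ofReal_mul hgN.le,
    ← ENNReal.ofReal_mul (exp_pos _).le, mul_assoc]

/-! ## §2. The secant letter of `−log Z + λ_wΣψ²` -/

/-- **THE SECANT LETTER (Prékopa–Leindler).**  `M ≻ 0` with floor `m·Σz² ≤ ⟨z,Mz⟩`; pairwise disjoint cells; measurable remainders with
`−κ₀t² ≤ w` (`κ₀ ≥ 0`) and the lower first-order letter of constant `λ_w ≥ 0`; `2λ_w ≤ m`; `M⁻¹ ⪯ γ_op·1`, `0 < τ`, `2κ₀(1+τ)γ_op ≤ θ < 1`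
⟹ for all `ψ₀, ψ₁` and `0 ≤ s ≤ 1`, with `W̃(ψ) = −log ∫e^{−Σw(ω+ψ)}dN(0,M⁻¹) + λ_wΣ_{p∈C}Σ_{u∈cell p}ψ_u²`:
`W̃((1−s)ψ₀ + sψ₁) ≤ (1−s)W̃(ψ₀) + sW̃(ψ₁)`. [cite: BrascampLieb1976, Thm 4.3] -/
theorem neg_log_step_secant (hM : M.PosDef) (hfl : ∀ z : ι → ℝ, m * ∑ i, z i ^ 2 ≤ z ⬝ᵥ (M *ᵥ z))
    (hΓop : (γop • (1 : Matrix ι ι ℝ) - M⁻¹).PosSemidef) (hdisj : ∀ p q, p ≠ q → Disjoint (cell p) (cell q))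
    (hw : ∀ x, Measurable (w x)) (hκ₀ : 0 ≤ κ₀) (hτ : 0 < τ) (hθ1 : θ < 1) (hκθ : 2 * κ₀ * (1 + τ) * γop ≤ θ)
    (hstab : ∀ x, ∀ t : ℝ, -(κ₀ * t ^ 2) ≤ w x t) (hlamw : 0 ≤ lamw)
    (hwlo : ∀ u (a b : ℝ), w u a + w' u a * (b - a) - lamw / 2 * (b - a) ^ 2 ≤ w u b) (hm : 2 * lamw ≤ m) (C : Finset V)
    (ψ₀ ψ₁ : EuclideanSpace ℝ ι) {s : ℝ} (hs0 : 0 ≤ s) (hs1 : s ≤ 1) :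
    -log (∫ ω : EuclideanSpace ℝ ι, exp (-(∑ p ∈ C, ∑ u ∈ cell p, w u (ω u + ((1 - s) • ψ₀ + s • ψ₁) u)))
        ∂(multivariateGaussian 0 M⁻¹)) + lamw * ∑ p ∈ C, ∑ u ∈ cell p, ((1 - s) • ψ₀ + s • ψ₁) u ^ 2 ≤
      (1 - s) * (-log (∫ ω : EuclideanSpace ℝ ι, exp (-(∑ p ∈ C, ∑ u ∈ cell p, w u (ω u + ψ₀ u))) ∂(multivariateGaussian 0 M⁻¹)) +
          lamw * ∑ p ∈ C, ∑ u ∈ cell p, ψ₀ u ^ 2) +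
        s * (-log (∫ ω : EuclideanSpace ℝ ι, exp (-(∑ p ∈ C, ∑ u ∈ cell p, w u (ω u + ψ₁ u))) ∂(multivariateGaussian 0 M⁻¹)) +
          lamw * ∑ p ∈ C, ∑ u ∈ cell p, ψ₁ u ^ 2) := by
  set μ := multivariateGaussian 0 M⁻¹ with hμ
  have hΓ : (M⁻¹).PosSemidef := hM.inv.posSemidef
  have hMT : Mᵀ = M := transpose_eq_of_posSemidef hM.posSemidef
  -- the three fluctuation integrals, their positivity and integrability
  have hint : ∀ φ : EuclideanSpace ℝ ι, Integrable (fun ω : EuclideanSpace ℝ ι => exp (-(∑ p ∈ C, ∑ u ∈ cell p, w u (ω u + φ u)))) μ := by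
    intro φ
    have h := integrable_exp_neg hΓ hΓop (C.biUnion cell) w hw hκ₀ hτ hθ1 hκθ hstab (fun x => φ x)
    refine h.congr (ae_of_all _ fun ω => ?_)
    simp only
    rw [cellSum_eq_sum_biUnion cell hdisj C]
  have hZ : ∀ φ : EuclideanSpace ℝ ι, 0 < ∫ ω : EuclideanSpace ℝ ι, exp (-(∑ p ∈ C, ∑ u ∈ cell p, w u (ω u + φ u))) ∂μ :=
    fun φ => integral_exp_pos (hint φ)
  -- interior case only matters; the endpoints are equalities
  rcases hs0.eq_or_lt with rfl | hs0'
  · simp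
  rcases hs1.eq_or_lt' with rfl | hs1'
  · simp
  set ψs : EuclideanSpace ℝ ι := (1 - s) • ψ₀ + s • ψ₁ with hψs
  have hψs_apply : ∀ u, ψs u = (1 - s) * ψ₀ u + s * ψ₁ u := fun u => by
    simp only [hψs, WithLp.ofLp_add, WithLp.ofLp_smul, Pi.add_apply, Pi.smul_apply, smul_eq_mul]
  -- Prékopa–Leindler on `ι → ℝ`
  have hPL := prekopaLeindler_fintype hs0' hs1'
    (measurable_jointAction_exp M cell hw lamw C (fun u => ψ₀ u)) (measurable_jointAction_exp M cell hw lamw C (fun u => ψ₁ u))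
    (measurable_jointAction_exp M cell hw lamw C (fun u => ψs u)) (fun x y => by
      rw [ENNReal.ofReal_rpow_of_nonneg (exp_pos _).le (by linarith), ENNReal.ofReal_rpow_of_nonneg (exp_pos _).le hs0,
        ← ENNReal.ofReal_mul (rpow_nonneg (exp_pos _).le _), ← exp_mul, ← exp_mul, ← exp_add]
      refine ENNReal.ofReal_le_ofReal (exp_le_exp.2 ?_)
      have key := jointAction_secant hMT hfl cell hdisj hlamw hwlo hm C x y (fun u => ψ₀ u) (fun u => ψ₁ u) hs0 hs1
      simp only [hψs_apply]
      linarith)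
  rw [lintegral_jointAction_eq hM cell hw lamw C (fun u => ψ₀ u) (hint ψ₀),
    lintegral_jointAction_eq hM cell hw lamw C (fun u => ψ₁ u) (hint ψ₁),
    lintegral_jointAction_eq hM cell hw lamw C (fun u => ψs u) (hint ψs)] at hPL
  -- back to reals and logarithms
  have hgN := gaussNorm_pos hM
  have hpos : ∀ (φ : EuclideanSpace ℝ ι), 0 < exp (-(lamw * ∑ p ∈ C, ∑ u ∈ cell p, φ u ^ 2)) * gaussNorm M *
      ∫ ω : EuclideanSpace ℝ ι, exp (-(∑ p ∈ C, ∑ u ∈ cell p, w u (ω u + φ u))) ∂μ :=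
    fun φ => mul_pos (mul_pos (exp_pos _) hgN) (hZ φ)
  rw [ENNReal.ofReal_rpow_of_nonneg (hpos ψ₀).le (by linarith), ENNReal.ofReal_rpow_of_nonneg (hpos ψ₁).le hs0,
    ← ENNReal.ofReal_mul (rpow_nonneg (hpos ψ₀).le _), ENNReal.ofReal_le_ofReal_iff (hpos ψs).le] at hPL
  have hlog := log_le_log (mul_pos (rpow_pos_of_pos (hpos ψ₀) _) (rpow_pos_of_pos (hpos ψ₁) _)) hPL
  rw [log_mul (rpow_pos_of_pos (hpos ψ₀) _).ne' (rpow_pos_of_pos (hpos ψ₁) _).ne', log_rpow (hpos ψ₀), log_rpow (hpos ψ₁),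
    log_mul (mul_pos (exp_pos _) hgN).ne' (hZ ψ₀).ne', log_mul (mul_pos (exp_pos _) hgN).ne' (hZ ψ₁).ne',
    log_mul (mul_pos (exp_pos _) hgN).ne' (hZ ψs).ne', log_mul (exp_pos _).ne' hgN.ne', log_mul (exp_pos _).ne' hgN.ne',
    log_mul (exp_pos _).ne' hgN.ne', log_exp, log_exp, log_exp] at hlog
  linarith

/-! ## §3. THE END: the lower letter -/

omit [DecidableEq ι] in
/-- **The derivative of the shift `λ_wΣ_{p∈C}Σ_{u∈cell p}ψ_u²`** at `ψ`: `h ↦ Σ_{p∈C}Σ_{u∈cell p}λ_w(2ψ_u)h_u`. [folklore] -/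
theorem hasFDerivAt_shift (cell : V → Finset ι) (lamw : ℝ) (C : Finset V) (ψ : EuclideanSpace ℝ ι) :
    HasFDerivAt (fun φ : EuclideanSpace ℝ ι => lamw * ∑ p ∈ C, ∑ u ∈ cell p, φ u ^ 2)
      (∑ p ∈ C, ∑ u ∈ cell p, (lamw * (2 * ψ u)) • (EuclideanSpace.proj u : EuclideanSpace ℝ ι →L[ℝ] ℝ)) ψ := by
  have hfun : (fun φ : EuclideanSpace ℝ ι => lamw * ∑ p ∈ C, ∑ u ∈ cell p, φ u ^ 2) =
      fun φ => ∑ p ∈ C, ∑ u ∈ cell p, lamw * φ u ^ 2 := by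
    funext φ; rw [mul_sum]; exact sum_congr rfl fun p _ => mul_sum _ _ _
  rw [hfun]
  refine HasFDerivAt.fun_sum fun p _ => HasFDerivAt.fun_sum fun u _ => ?_
  have hq : HasDerivAt (fun t : ℝ => lamw * t ^ 2) (lamw * (2 * ψ u)) (ψ u) := by
    simpa using (hasDerivAt_pow 2 (ψ u)).const_mul lamw
  have h := hq.comp_hasFDerivAt ψ (EuclideanSpace.proj u : EuclideanSpace ℝ ι →L[ℝ] ℝ).hasFDerivAt
  exact h

omit [Fintype ι] [DecidableEq ι] in
/-- The shift's derivative applied to `h`. [folklore] -/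
theorem shiftDeriv_apply (cell : V → Finset ι) (lamw : ℝ) (C : Finset V) (ψ h : EuclideanSpace ℝ ι) :
    (∑ p ∈ C, ∑ u ∈ cell p, (lamw * (2 * ψ u)) • (EuclideanSpace.proj u : EuclideanSpace ℝ ι →L[ℝ] ℝ)) h =
      ∑ p ∈ C, ∑ u ∈ cell p, lamw * (2 * ψ u) * h u := by
  simp only [_root_.sum_apply, _root_.smul_apply, smul_eq_mul]
  rfl

/-- **THE END — THE LOWER SECOND-ORDER LETTER OF THE NEXT POTENTIAL.**  `M ≻ 0` with floor `m·Σz² ≤ ⟨z,Mz⟩` and `M⁻¹ ⪯ γ_op·1`;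
pairwise disjoint cells; `w_x ∈ C¹` with `w'_x` measurable, `|w'_x(t)| ≤ κ₁|t|` (`κ₁ ≥ 0`), `−κ₀t² ≤ w_x(t)` (`κ₀ ≥ 0`) and the LOWER letter
`w_x(a) + w'_x(a)(b−a) − ½λ_w(b−a)² ≤ w_x(b)` (`λ_w ≥ 0`, `2λ_w ≤ m`); `0 < τ`, `0 < δ`, `0 < θ < 1`, `(2κ₀(1+τ)+4δ)γ_op ≤ θ` ⟹ at EVERY `ψ, ψ'`:
`−log Z(ψ) + (fderiv ℝ (−log Z) ψ)(ψ'−ψ) − λ_w·Σ_{p∈C}Σ_{u∈cell p}(ψ'_u−ψ_u)² ≤ −log Z(ψ')`, `Z(ψ) = ∫e^{−Σ_{p∈C}Σ_{u∈cell p}w_u(ω_u+ψ_u)}dN(0,M⁻¹)`.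
[cite: BrascampLieb1976, Thm 4.3] -/
theorem neg_log_step_lower_letter (hM : M.PosDef) (hfl : ∀ z : ι → ℝ, m * ∑ i, z i ^ 2 ≤ z ⬝ᵥ (M *ᵥ z))
    (hΓop : (γop • (1 : Matrix ι ι ℝ) - M⁻¹).PosSemidef) (hdisj : ∀ p q, p ≠ q → Disjoint (cell p) (cell q))
    (hw' : ∀ x t, HasDerivAt (w x) (w' x t) t) (hw'm : ∀ x, Measurable (w' x)) (hκ₀ : 0 ≤ κ₀) (hκ₁ : 0 ≤ κ₁) (hτ : 0 < τ)
    (hδ : 0 < δ) (hθ0 : 0 < θ) (hθ1 : θ < 1) (hκθ : (2 * κ₀ * (1 + τ) + 4 * δ) * γop ≤ θ)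
    (hstab : ∀ x, ∀ t : ℝ, -(κ₀ * t ^ 2) ≤ w x t) (hw'b : ∀ x t, |w' x t| ≤ κ₁ * |t|) (hlamw : 0 ≤ lamw)
    (hwlo : ∀ u (a b : ℝ), w u a + w' u a * (b - a) - lamw / 2 * (b - a) ^ 2 ≤ w u b) (hm : 2 * lamw ≤ m) (C : Finset V)
    (ψ ψ' : EuclideanSpace ℝ ι) :
    -log (∫ ω : EuclideanSpace ℝ ι, exp (-(∑ p ∈ C, ∑ u ∈ cell p, w u (ω u + ψ u))) ∂(multivariateGaussian 0 M⁻¹)) +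
        fderiv ℝ (fun φ : EuclideanSpace ℝ ι =>
          -log (∫ ω : EuclideanSpace ℝ ι, exp (-(∑ p ∈ C, ∑ u ∈ cell p, w u (ω u + φ u))) ∂(multivariateGaussian 0 M⁻¹))) ψ (ψ' - ψ) -
        lamw * ∑ p ∈ C, ∑ u ∈ cell p, (ψ' u - ψ u) ^ 2 ≤
      -log (∫ ω : EuclideanSpace ℝ ι, exp (-(∑ p ∈ C, ∑ u ∈ cell p, w u (ω u + ψ' u))) ∂(multivariateGaussian 0 M⁻¹)) := by
  set μ := multivariateGaussian 0 M⁻¹ with hμ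
  have hΓ : (M⁻¹).PosSemidef := hM.inv.posSemidef
  have hw : ∀ x, Measurable (w x) := fun x => (continuous_iff_continuousAt.2 fun t => (hw' x t).continuousAt).measurable
  have hκθ₁ : 2 * κ₀ * (1 + τ) * γop ≤ θ :=
    SupEffectiveActionDerivative.mul_opBound_le_of_le (by positivity) (by linarith) hθ0.le hκθ
  -- the derivative of `W̃ = −log Z + λ_wΣψ²`
  have hd := (hasFDerivAt_neg_log_step hΓ hΓop hdisj hw' hw'm hκ₀ hκ₁ hτ hδ hθ0 hθ1 hκθ hstab hw'b C ψ).add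
    (hasFDerivAt_shift cell lamw C ψ)
  -- secant ⟹ first order, with zero gain
  have key := firstOrder_of_secant_hasFDerivAt' (μ := 0) (R := 0) hd fun s hs0 hs1 => by
    have h := neg_log_step_secant hM hfl hΓop hdisj hw hκ₀ hτ hθ1 hκθ₁ hstab hlamw hwlo hm C ψ ψ' hs0.le hs1.le
    have e : ψ + s • (ψ' - ψ) = (1 - s) • ψ + s • ψ' := by
      rw [smul_sub, sub_smul, one_smul]; abel
    rw [e]
    simp only [Pi.add_apply]
    linarith
  simp only [Pi.add_apply, _root_.add_apply, zero_div, zero_mul, add_zero] at key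
  rw [shiftDeriv_apply] at key
  rw [(hasFDerivAt_neg_log_step hΓ hΓop hdisj hw' hw'm hκ₀ hκ₁ hτ hδ hθ0 hθ1 hκθ hstab hw'b C ψ).fderiv]
  -- the quadratic bookkeeping `λ_wΣψ'² − λ_wΣψ² − Σλ_w(2ψ)(ψ'−ψ) = λ_wΣ(ψ'−ψ)²`
  have hsq : lamw * ∑ p ∈ C, ∑ u ∈ cell p, ψ' u ^ 2 - lamw * ∑ p ∈ C, ∑ u ∈ cell p, ψ u ^ 2 -
      ∑ p ∈ C, ∑ u ∈ cell p, lamw * (2 * ψ u) * (ψ' - ψ) u = lamw * ∑ p ∈ C, ∑ u ∈ cell p, (ψ' u - ψ u) ^ 2 := by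
    simp only [mul_sum, ← sum_sub_distrib, WithLp.ofLp_sub, Pi.sub_apply]
    exact sum_congr rfl fun p _ => sum_congr rfl fun u _ => by ring
  linarith [hsq]

end Main

/-! ## §4. Toy -/

/-- Toy (§3): the shift's derivative on a one-cell, one-site lattice, applied to `h`. -/
example (ψ h : EuclideanSpace ℝ (Fin 1)) :
    (∑ p ∈ ({()} : Finset Unit), ∑ u ∈ (fun _ : Unit => (Finset.univ : Finset (Fin 1))) p,
        ((2 : ℝ) * (2 * ψ u)) • (EuclideanSpace.proj u : EuclideanSpace ℝ (Fin 1) →L[ℝ] ℝ)) h =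
      ∑ p ∈ ({()} : Finset Unit), ∑ u ∈ (fun _ : Unit => (Finset.univ : Finset (Fin 1))) p, (2 : ℝ) * (2 * ψ u) * h u :=
  shiftDeriv_apply (fun _ : Unit => Finset.univ) 2 {()} ψ h

end Summit.QuantumFields.BalabanUV.T4Continuum.NE7b.SupEffectiveActionLowerLetter
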